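import Mathlib
import Summits.ValiantsHypothesis.ValiantsHypothesis.Theorems.BarrierLeverPartitionMinorsHitByVPHiddenStatesFullJoinInvariance

/-!
# Route BarrierLever — item `PartitionMinorsHitByVP` (stmt-ValiantsHypothesis-19717), line `hidden_states`:
# FULL-JOIN BOOKKEEPING — padding by an idle state, and independence of the enumeration

Helper file (`--supports stmt-ValiantsHypothesis-19717`; cell valiant-natproofs, rung V4, 𝒟-side door (c), line
`Cruxes/PartitionMinorsHitByVP/Lines/hidden_states.lean` v8; prover seat val-np-p3 gen 16). Definition-free. Closes NO item.

Two lemmas needed to run the PEEL⁺ induction (memo val-np-p3 g16 §9) on FAMILIES of pairs: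
* `fullJoinCube_pad` — FJ with `K` states implies FJ with `K + 1` states (add an idle state of weight `0`; the sum over the state sets
  containing it vanishes and the rest is the old sum, `sum_pad`);
* `fullJoinCube_of_range_eq` — FJ for one pair of injective enumerations implies FJ for every pair of injective enumerations with the same
  two RANGES (the enumerations differ by permutations of `Fin r`; `fullJoin_reindex`, p676375).

WHAT THIS IS NOT: no pair is certified here; item 19717 stays OPEN; nothing on crux 14610 or VP ≠ VNP.
-/

set_option linter.dupNamespace false

namespace Summit.ValiantsHypothesis.ValiantsHypothesis.Theorems.BarrierLever.HiddenStates

open Finset Matrix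

noncomputable section

namespace FullJoin

variable {h K r : ℕ}

/-- Summing a function of state sets over `Finset (Fin (K+1))` when it vanishes on every set containing `Fin.last K`: only the images of
`Finset (Fin K)` under `castSucc` contribute. -/
theorem sum_pad (f : Finset (Fin (K + 1)) → ℂ) (hf : ∀ J, Fin.last K ∈ J → f J = 0) :
    ∑ J : Finset (Fin (K + 1)), f J = ∑ J₀ : Finset (Fin K), f (J₀.map Fin.castSuccEmb) := by
  classical
  have huniv : (Finset.univ : Finset (Finset (Fin (K + 1)))) =
      (insert (Fin.last K) ((Finset.univ : Finset (Fin K)).map Fin.castSuccEmb)).powerset := by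
    rw [← Finset.powerset_univ, Fin.univ_castSuccEmb, Finset.cons_eq_insert]
  have hlast : Fin.last K ∉ (Finset.univ : Finset (Fin K)).map Fin.castSuccEmb := by simp [Finset.mem_map]
  rw [huniv, Finset.sum_powerset_insert hlast]
  have hzero : ∑ J ∈ ((Finset.univ : Finset (Fin K)).map Fin.castSuccEmb).powerset, f (insert (Fin.last K) J) = 0 :=
    Finset.sum_eq_zero fun J _ => hf _ (Finset.mem_insert_self _ _)
  rw [hzero, add_zero]
  have hpow : ((Finset.univ : Finset (Fin K)).map Fin.castSuccEmb).powerset =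
      (Finset.univ : Finset (Fin K)).powerset.image (fun J₀ => J₀.map Fin.castSuccEmb) := by
    rw [Finset.map_eq_image, Finset.powerset_image]
    refine Finset.image_congr fun J₀ _ => ?_
    rw [Finset.map_eq_image]
  rw [hpow, Finset.sum_image (fun J₀ _ J₁ _ hJ => Finset.map_injective Fin.castSuccEmb hJ), Finset.powerset_univ]

/-- **Padding by an idle state.** FJ with `K` states implies FJ with `K + 1` states: give the new state `Fin.last K` zero table vectors
and weight `0`. -/
theorem fullJoinCube_pad (u w : Fin r → Finset (Fin h))
    (H : ∃ (tx ty : Option (Fin K) → Fin h → ℂ) (lam : Fin K → ℂ),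
      (Matrix.of fun i j : Fin r => ∑ J : Finset (Fin K), (∏ q ∈ J, lam q) *
        ((∏ a ∈ u i, (tx none a + ∑ q ∈ J, tx (some q) a)) * ∏ c ∈ w j, (ty none c + ∑ q ∈ J, ty (some q) c))).det ≠ 0) :
    ∃ (tx ty : Option (Fin (K + 1)) → Fin h → ℂ) (lam : Fin (K + 1) → ℂ),
      (Matrix.of fun i j : Fin r => ∑ J : Finset (Fin (K + 1)), (∏ q ∈ J, lam q) *
        ((∏ a ∈ u i, (tx none a + ∑ q ∈ J, tx (some q) a)) * ∏ c ∈ w j, (ty none c + ∑ q ∈ J, ty (some q) c))).det ≠ 0 := by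
  classical
  obtain ⟨tx, ty, lam, hdet⟩ := H
  let tx' : Option (Fin (K + 1)) → Fin h → ℂ := fun o a => o.elim (tx none a) (fun q => Fin.lastCases 0 (fun q₀ => tx (some q₀) a) q)
  let ty' : Option (Fin (K + 1)) → Fin h → ℂ := fun o c => o.elim (ty none c) (fun q => Fin.lastCases 0 (fun q₀ => ty (some q₀) c) q)
  let lam' : Fin (K + 1) → ℂ := Fin.lastCases 0 lam
  refine ⟨tx', ty', lam', ?_⟩
  have hmat : (Matrix.of fun i j : Fin r => ∑ J : Finset (Fin (K + 1)), (∏ q ∈ J, lam' q) *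
        ((∏ a ∈ u i, (tx' none a + ∑ q ∈ J, tx' (some q) a)) * ∏ c ∈ w j, (ty' none c + ∑ q ∈ J, ty' (some q) c))) =
      Matrix.of fun i j : Fin r => ∑ J : Finset (Fin K), (∏ q ∈ J, lam q) *
        ((∏ a ∈ u i, (tx none a + ∑ q ∈ J, tx (some q) a)) * ∏ c ∈ w j, (ty none c + ∑ q ∈ J, ty (some q) c)) := by
    refine Matrix.ext fun i j => ?_
    rw [Matrix.of_apply, Matrix.of_apply]
    rw [sum_pad _ (fun J hJ => by
      rw [Finset.prod_eq_zero hJ (by simp [lam', Fin.lastCases_last]), zero_mul])]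
    refine Finset.sum_congr rfl fun J₀ _ => ?_
    simp only [Finset.prod_map, Finset.sum_map, Fin.castSuccEmb_apply, lam', tx', ty', Fin.lastCases_castSucc, Option.elim]
  rw [hmat]
  exact hdet

/-- Two injective enumerations with the same range differ by a permutation. -/
theorem exists_perm_of_range_eq (u u' : Fin r → Finset (Fin h)) (hu' : Function.Injective u')
    (hrange : Set.range u' = Set.range u) : ∃ ρ : Equiv.Perm (Fin r), ∀ i, u' i = u (ρ i) := by
  classical
  have hex : ∀ i, ∃ j, u j = u' i := fun i => by
    have : u' i ∈ Set.range u := hrange ▸ Set.mem_range_self i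
    exact this
  choose f hf using hex
  have hinj : Function.Injective f := fun i i' hii' => hu' (by rw [← hf i, ← hf i', hii'])
  have hbij : Function.Bijective f := (Finite.injective_iff_bijective).mp hinj
  exact ⟨Equiv.ofBijective f hbij, fun i => (hf i).symm⟩

/-- **Independence of the enumeration.** FJ for `(u, w)` implies FJ for every pair `(u', w')` of injective enumerations with the same two
ranges. -/
theorem fullJoinCube_of_range_eq (u w u' w' : Fin r → Finset (Fin h))
    (hu' : Function.Injective u') (hw' : Function.Injective w') (hru : Set.range u' = Set.range u) (hrw : Set.range w' = Set.range w)
    (H : ∃ (tx ty : Option (Fin K) → Fin h → ℂ) (lam : Fin K → ℂ),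
      (Matrix.of fun i j : Fin r => ∑ J : Finset (Fin K), (∏ q ∈ J, lam q) *
        ((∏ a ∈ u i, (tx none a + ∑ q ∈ J, tx (some q) a)) * ∏ c ∈ w j, (ty none c + ∑ q ∈ J, ty (some q) c))).det ≠ 0) :
    ∃ (tx ty : Option (Fin K) → Fin h → ℂ) (lam : Fin K → ℂ),
      (Matrix.of fun i j : Fin r => ∑ J : Finset (Fin K), (∏ q ∈ J, lam q) *
        ((∏ a ∈ u' i, (tx none a + ∑ q ∈ J, tx (some q) a)) * ∏ c ∈ w' j, (ty none c + ∑ q ∈ J, ty (some q) c))).det ≠ 0 := by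
  obtain ⟨ρ, hρ⟩ := exists_perm_of_range_eq u u' hu' hru
  obtain ⟨ρ', hρ'⟩ := exists_perm_of_range_eq w w' hw' hrw
  have H' := fullJoin_reindex u w ρ ρ' H
  have hu'' : u' = fun i => u (ρ i) := funext hρ
  have hw'' : w' = fun j => w (ρ' j) := funext hρ'
  rw [hu'', hw'']
  exact H'

end FullJoin

end

end Summit.ValiantsHypothesis.ValiantsHypothesis.Theorems.BarrierLever.HiddenStates
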